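import Summits.ABC.IUTFork.LDHTensorStepVM
import Literature.IUT.LogVolume.GenuineLogTheta
import HarnessLib

/-!
# The fork at [IUTchIII] Corollary 3.12, L-DH level: the Dupuy–Hilado datum OF a genuine Θ-volume input
# (route D3 `defn-NegLogThetaAtDatum`, part c — the bridge `DHData.ofInput`)

Record-only file (D-0012) of the abc-iut cell (campaign-S seat abc-iut-S2); TAKES NO SIDE. Dupuy–Hilado,
arXiv:2004.13228 (pre-split text) §1 (1.1), Def. 3.6.3, §3.9, §4.10–4.12; [IUTchIII] Cor. 3.12 (kurims p. 173–174);
[IUTchIV] Thm. 1.10 Step (vii) (kurims p. 30).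

The Literature-level file `GenuineLogTheta.lean` DEFINES `−|log(Θ)|` (`ThetaVolumeInput.negLogTheta`, nonarch-
imedean part `negLogThetaNonarch`) and `−|log(q)|` (`negAbsLogQ`) from a GENUINE input `I : ThetaVolumeInput F₀ K`
(pilot data over `F₀`, the extension field `K`, a section of places, ideles in the actual completions `K_{v̲}`), because the route's
Theses file can import `Literature.*` only. The Dupuy–Hilado bookkeeping (`DHData`, Thm. 3.10.1, (1.1) as
`Cor312DH`, the squeeze, abc-iut-c312-d1's per-summand Step (v) estimate) lives HERE, summit-side. This file
identifies the two:

* `DHData.ofInput I := DHData.ofIdelesM I.X I.σ.localFieldFamily I.tΘ … I.supportPrimes …` — abc-iut-c312-3's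
  datum over the tensor-packet model in Mochizuki's log-shell normalisation, built from the ideles ALONE with the
  MINIMAL (= SHARP, planner ruling R6-b) (Ind3)-datum, fed with the GENUINE local-field family of the input;
* the `rfl` bridges between the Literature twins and the summit-side `p`-local quantities
  (`regionOf = pilotRegion`, `localUTheta = possibleImages`, `localHull = possibleImagesHull`);
* **`negLogThetaDH_ofInput : (ofInput I).negLogThetaDH = I.negLogThetaNonarch`** and
  **`negAbsLogqDH_ofInput : (ofInput I).negAbsLogqDH = I.negAbsLogQ`** — Dupuy–Hilado's `ln ν̄_𝕃(hull(U_Θ))` and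
  `ln ν̄_𝕃(O_𝕃(−P_q))` of this datum ARE the Literature numbers (the second is Thm. 3.10.1 at `P_q`);
* hence `cor312DH_ofInput_iff : (ofInput I).Cor312DH ↔ I.Cor312NonarchOf` (Dupuy–Hilado's (1.1) verbatim),
  `cor312Of_of_cor312DH` (Dupuy–Hilado's (1.1) omits `𝕍^arc` and is the STRONGER form: [IUTchIII]'s `−|log(Θ)|`
  carries the archimedean summand `((l+5)/4)·log π > 0` of [IUTchIV] Step (vii)), `estimateDH_ofInput_iff :
  (ofInput I).EstimateDH δ ↔ I.HullEstimateOf δ`, the free inequality `−deĝ̲_lgp(P_Θ) ≤ negLogThetaNonarch I`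
  UNCONDITIONALLY (hull admissibility, Thm. 3.10.1, (Ind1)/(Ind2)-invariance all theorems of Haar measure on the
  genuine `⊗_{ℚ_p} K_{v̲_i}`), and the SHARPNESS of the datum on the support primes (`ofInput_sharp`, the `hsharp`
  hypothesis shape of c312-d1's estimates);
* **`hullEstimateOf_ofInput : I.HullEstimateOf (explicitDelta I)`** — THE COMPUTABLE HALF HOLDS for every genuine
  input with abc-iut-c312-d1's explicit Step (v) constant (`estimateDH_ofIdelesM`, nothing assumed), and the
  squeeze `gap_le_of_cor312Of` modulo Cor. 3.12 ONLY.

[cite: DupuyHilado2025, §1 (1.1), Def. 3.6.3, §3.9, §4.10–4.12] [cite: Mochizuki2012, IUTchIII Cor. 3.12 p. 173–174]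
[claim: Mochizuki2012, status: disputed] Nothing asserted: `Cor312DH`/`Cor312Of` remain hypotheses. Deliberately
NOT here: the point-level specialisation to `(P, l)` (Literature `GenuineLogThetaPoint`), the value of the estimate
constant (c312-d1 `LDHTensorStepV`), which (Ind3) reading the text means (R6 at ref-b).
-/

noncomputable section

open Set

namespace Literature.IUT.LogVolume

namespace PrimePacket

variable {F : Type} [Field F] [NumberField F] {p : ℕ} (Q : PrimePacket F p)

/-- The Literature twin `pilotRegion` IS the summit-side `regionOf` (same formula). [cite: DupuyHilado2025, §3.9] -/
theorem regionOf_eq_pilotRegion {lstar : ℕ} (t : Fin lstar → (v : placesOver F p) → Q.Λ v) :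
    Q.regionOf t = Q.pilotRegion t := rfl

/-- The Literature twin `possibleImages` IS the summit-side `localUTheta`. [cite: DupuyHilado2025, §4.11] -/
theorem localUTheta_eq_possibleImages (B : Q.Region) : Q.localUTheta B = Q.possibleImages B := rfl

/-- The Literature twin `possibleImagesHull` IS the summit-side `localHull`. [cite: DupuyHilado2025, §4.12] -/
theorem localHull_eq_possibleImagesHull (B : Q.Region) : Q.localHull B = Q.possibleImagesHull B := rfl

/-- `−|log(Θ)|_p` of the Literature file is `ln ν̄_{𝕃_p}` of the summit-side local hull of `O_𝕃(−div t)_p`.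
[cite: DupuyHilado2025, §4.11–4.12] -/
theorem negLogThetaAt_eq (lstar : ℕ) (t : Fin lstar → (v : placesOver F p) → Q.Λ v) :
    Q.negLogThetaAt lstar t = Q.lnνLp lstar (Q.localHull (Q.regionOf t)) := rfl

/-- **Evaluation of a `dite`-assembled datum at a true index**: for the packet `if h : c then A h else B h` and the
datum transported componentwise (the shape of c312-3's `DHData.ofPrimesLine`), any function of (packet, datum)
evaluates at a proof `hc : c` to its value on `(A hc, dA hc)`. (Case analysis on the `Decidable` instance; the
transports along `dif_pos`/`dif_neg` reduce by K-like reduction.) [cite: DupuyHilado2025, Def. 3.6.3] -/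
theorem DHDatum.dite_eval {X : PilotData F} {α : Sort*} (c : Prop) [inst : Decidable c] (hc : c)
    (A : c → PrimePacket F p) (B : ¬c → PrimePacket F p) (dA : ∀ h, (A h).DHDatum X) (dB : ∀ h, (B h).DHDatum X)
    (Ψ : ∀ Q : PrimePacket F p, Q.DHDatum X → α) :
    Ψ (dite c A B) (dite c (fun h => DHDatum.transport (dif_pos h) (dA h))
      (fun h => DHDatum.transport (dif_neg h) (dB h))) = Ψ (A hc) (dA hc) := by
  cases inst with
  | isFalse h => exact absurd hc h
  | isTrue h => rfl

end PrimePacket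

end Literature.IUT.LogVolume

namespace Summit.ABC.IUTFork

open Literature.IUT.LogVolume NumberField IsDedekindDomain
open Literature.NumberTheory.GaloisRepresentations.Ultrametric
open scoped Pointwise

variable {F₀ : Type} [Field F₀] [NumberField F₀] {K : Type} [Field K] [NumberField K] [Algebra F₀ K]

namespace DHData

/-! ## Evaluation of c312-3's idele-built datum `ofIdelesM` at a prime (any local-field family) -/

section IdelesM

variable (X : PilotData F₀) (𝔽 : LocalFieldFamily F₀)
  (tΘ : ∀ (p : ℕ) (hp : p.Prime), Fin X.lstar → (v : placesOver F₀ p) → (@LocalFields.k F₀ _ _ p ⟨hp⟩ (𝔽 p hp) v)ˣ)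
  (tΘ_ord : ∀ (p : ℕ) (hp : p.Prime) (i : Fin X.lstar) (v : placesOver F₀ p),
    @LocalFields.ordv F₀ _ _ p ⟨hp⟩ (𝔽 p hp) v (tΘ p hp i v) = X.thetaPilot i v.1)
  (tq : ∀ (p : ℕ) (hp : p.Prime), Fin X.lstar → (v : placesOver F₀ p) → (@LocalFields.k F₀ _ _ p ⟨hp⟩ (𝔽 p hp) v)ˣ)
  (tq_ord : ∀ (p : ℕ) (hp : p.Prime) (i : Fin X.lstar) (v : placesOver F₀ p),
    @LocalFields.ordv F₀ _ _ p ⟨hp⟩ (𝔽 p hp) v (tq p hp i v) = X.qPilot v.1)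
  (T : Finset ℕ) (T_prime : ∀ p ∈ T, p.Prime) (S_sub : ∀ v ∈ X.S, residueChar F₀ v ∈ T)

/-- The packets-at-every-index of `ofIdelesM`: the real packet (Mochizuki normalisation) at a prime, the valuation
line at a composite index (c312-3's `ofPrimesLine` shape, named for the evaluation lemmas).
[cite: DupuyHilado2025, Def. 3.6.3] -/
private def PallG (p : ℕ) : PrimePacket F₀ p :=
  if hp : p.Prime then @realPrimePacketM F₀ _ _ p ⟨hp⟩ (𝔽 p hp) else PrimePacket.line F₀ p

/-- The data-at-every-index of `ofIdelesM` (minimal datum at primes, line datum at composites).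
[cite: DupuyHilado2025, Def. 3.6.3] -/
private def dAllG (p : ℕ) : (PallG 𝔽 p).DHDatum X :=
  if hp : p.Prime then
    PrimePacket.DHDatum.transport (dif_pos hp)
      (@PrimePacket.minimalDHDatumM F₀ _ _ p ⟨hp⟩ (𝔽 p hp) X (tΘ p hp) (tΘ_ord p hp) (tq p hp) (tq_ord p hp))
  else PrimePacket.DHDatum.transport (dif_neg hp) (PrimePacket.lineDatum p X)

/-- `ofIdelesM` unfolded to c312-3's primewise assembly (definitional). [cite: DupuyHilado2025, Def. 3.6.3] -/
private theorem ofIdelesM_eq_ofPrimewise :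
    ofIdelesM X 𝔽 tΘ tΘ_ord tq tq_ord T T_prime S_sub =
      DHData.ofPrimewise X (PallG 𝔽) (dAllG X 𝔽 tΘ tΘ_ord tq tq_ord) T T_prime S_sub := rfl

/-- A function of (packet, datum) evaluated on the assembly at a prime is its value on the real packet and the
minimal datum there. [cite: DupuyHilado2025, Def. 3.6.3] -/
private theorem evalG {α : Sort*} {p : ℕ} (hp : p.Prime) (Ψ : ∀ Q : PrimePacket F₀ p, Q.DHDatum X → α) :
    Ψ (PallG 𝔽 p) (dAllG X 𝔽 tΘ tΘ_ord tq tq_ord p) =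
      Ψ (@realPrimePacketM F₀ _ _ p ⟨hp⟩ (𝔽 p hp)) (@PrimePacket.minimalDHDatumM F₀ _ _ p ⟨hp⟩ (𝔽 p hp) X
        (tΘ p hp) (tΘ_ord p hp) (tq p hp) (tq_ord p hp)) := by
  unfold PallG dAllG
  exact PrimePacket.DHDatum.dite_eval (X := X) (p.Prime) hp _ _ _ _ Ψ

/-- **`ln ν̄_{𝕃_p}(hull(U_Θ)_p)` of the idele-built datum, at a prime `p`, is the local-hull volume of the REAL packet
at `p`** (the `p`-part of the assembled model evaluated through the `dite`/transport of `ofPrimesLine`).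
[cite: DupuyHilado2025, Def. 3.6.3, §4.11–4.12] -/
theorem ofIdelesM_lnνLp_hullUTheta {p : ℕ} (hp : p.Prime) :
    (ofIdelesM X 𝔽 tΘ tΘ_ord tq tq_ord T T_prime S_sub).M.lnνLp X.lstar p
        ((ofIdelesM X 𝔽 tΘ tΘ_ord tq tq_ord T T_prime S_sub).M.hullUTheta
          (ofIdelesM X 𝔽 tΘ tΘ_ord tq tq_ord T T_prime S_sub).ind3) =
      (@realPrimePacketM F₀ _ _ p ⟨hp⟩ (𝔽 p hp)).lnνLp X.lstar
        ((@realPrimePacketM F₀ _ _ p ⟨hp⟩ (𝔽 p hp)).localHull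
          ((@realPrimePacketM F₀ _ _ p ⟨hp⟩ (𝔽 p hp)).regionOf (tΘ p hp))) := by
  set D := ofIdelesM X 𝔽 tΘ tΘ_ord tq tq_ord T T_prime S_sub with hD
  rw [IndPacketModel.lnνLp_eq_primePart]
  have h : D.M.regionAt (D.M.hullUTheta D.ind3) p =
      (D.M.primePart p).localHull (D.M.regionAt D.ind3.bare3 p) := by
    funext j e
    exact IndPacketModel.hullUTheta_eq_localHull _ _ p j e
  rw [h]
  show (PallG 𝔽 p).lnνLp X.lstar ((PallG 𝔽 p).localHull (dAllG X 𝔽 tΘ tΘ_ord tq tq_ord p).bare3) = _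
  exact evalG X 𝔽 tΘ tΘ_ord tq tq_ord hp (fun Q d => Q.lnνLp X.lstar (Q.localHull d.bare3))

/-- **`ln ν̄_{𝕃_p}(O_𝕃(−P_q)_p)` of the idele-built datum, at a prime `p`, is the region volume of the real packet.**
[cite: DupuyHilado2025, Def. 3.6.3, §3.9] -/
theorem ofIdelesM_lnνLp_region_tq {p : ℕ} (hp : p.Prime) :
    (ofIdelesM X 𝔽 tΘ tΘ_ord tq tq_ord T T_prime S_sub).M.lnνLp X.lstar p
        ((ofIdelesM X 𝔽 tΘ tΘ_ord tq tq_ord T T_prime S_sub).M.region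
          (ofIdelesM X 𝔽 tΘ tΘ_ord tq tq_ord T T_prime S_sub).tq) =
      (@realPrimePacketM F₀ _ _ p ⟨hp⟩ (𝔽 p hp)).lnνLp X.lstar
        ((@realPrimePacketM F₀ _ _ p ⟨hp⟩ (𝔽 p hp)).regionOf (tq p hp)) := by
  rw [IndPacketModel.lnνLp_eq_primePart, IndPacketModel.region_eq_regionOf]
  show (PallG 𝔽 p).lnνLp X.lstar ((PallG 𝔽 p).regionOf (dAllG X 𝔽 tΘ tΘ_ord tq tq_ord p).tq) = _
  exact evalG X 𝔽 tΘ tΘ_ord tq tq_ord hp (fun Q d => Q.lnνLp X.lstar (Q.regionOf d.tq))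

/-- **The idele-built datum is SHARP at every prime**: `(O_𝕃(−P_Θ))^{Ind3}_{p,j,v⃗} = O_𝕃(−P_Θ)_{p,j,v⃗}` (c312-3's
`minimalDHDatumM_bare3`, read through the assembly — the global form recorded as a follow-up in c312-3's 23:30Z
handoff). [cite: DupuyHilado2025, §4.10] -/
theorem ofIdelesM_bare3 {p : ℕ} (hp : p.Prime) (j : ℕ) (e : Fin (j + 1) → placesOver F₀ p) :
    (ofIdelesM X 𝔽 tΘ tΘ_ord tq tq_ord T T_prime S_sub).ind3.bare3 p j e =
      (ofIdelesM X 𝔽 tΘ tΘ_ord tq tq_ord T T_prime S_sub).M.region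
        (ofIdelesM X 𝔽 tΘ tΘ_ord tq tq_ord T T_prime S_sub).tΘ p j e := by
  set D := ofIdelesM X 𝔽 tΘ tΘ_ord tq tq_ord T T_prime S_sub with hD
  show (dAllG X 𝔽 tΘ tΘ_ord tq tq_ord p).bare3 j e = D.M.regionAt (D.M.region D.tΘ) p j e
  rw [IndPacketModel.region_eq_regionOf]
  show (dAllG X 𝔽 tΘ tΘ_ord tq tq_ord p).bare3 j e =
    (PallG 𝔽 p).regionOf (dAllG X 𝔽 tΘ tΘ_ord tq tq_ord p).tΘ j e
  exact (evalG X 𝔽 tΘ tΘ_ord tq tq_ord hp (fun Q d => (d.bare3 j e = Q.regionOf d.tΘ j e : Prop))).mpr rfl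

end IdelesM

/-! ## The datum of a genuine input -/

variable (I : ThetaVolumeInput F₀ K)

/-- **The Dupuy–Hilado datum OF a genuine Θ-volume input**: c312-3's idele-built datum over the tensor-packet model
in Mochizuki's normalisation (`DHData.ofIdelesM`: minimal = sharp (Ind3)-datum), fed with the genuine local-field
family `I.σ.localFieldFamily` (completions `K_{v̲}`), the input's ideles and pilot data, over the support primes
`T(I)`. [cite: DupuyHilado2025, §3.9, §4.10–4.12] -/
def ofInput : DHData F₀ :=
  DHData.ofIdelesM I.X I.σ.localFieldFamily I.tΘ I.tΘ_ord I.tq I.tq_ord I.supportPrimes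
    (fun _ hp => I.prime_of_mem_supportPrimes hp) (fun _ hv => I.residueChar_mem_supportPrimes hv)

/-- Its pilot data are the input's. [cite: DupuyHilado2025, §3.3] -/
theorem ofInput_X : (ofInput I).X = I.X := rfl

/-- Its model is the tensor-packet model (Mochizuki normalisation) over the genuine completions.
[cite: DupuyHilado2025, Def. 3.6.1] -/
theorem ofInput_M : (ofInput I).M = tensorPacketModelM I.σ.localFieldFamily := rfl

/-- Its primes are the input's support primes. [cite: DupuyHilado2025, Def. 3.6.3] -/
theorem ofInput_T : (ofInput I).T = I.supportPrimes := rfl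

/-! ## `−|log(Θ)|`: the summit-side hull volume IS the Literature number -/

/-- At a prime `p`, `ln ν̄_{𝕃_p}(hull(U_Θ)_p)` of the datum is the input's local summand `negLogThetaLoc p`.
[cite: DupuyHilado2025, Def. 3.6.3, §4.11–4.12] -/
theorem lnνLp_hullUTheta_ofInput {p : ℕ} (hp : p.Prime) :
    (ofInput I).M.lnνLp I.lstar p ((ofInput I).M.hullUTheta (ofInput I).ind3) = I.negLogThetaLoc p := by
  rw [I.negLogThetaLoc_of_prime hp]
  exact ofIdelesM_lnνLp_hullUTheta I.X I.σ.localFieldFamily I.tΘ I.tΘ_ord I.tq I.tq_ord I.supportPrimes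
    (fun _ hp => I.prime_of_mem_supportPrimes hp) (fun _ hv => I.residueChar_mem_supportPrimes hv) hp

/-- **`ln ν̄_𝕃(hull(U_Θ)) = negLogThetaNonarch I`**: Dupuy–Hilado's `−|log(Θ)|` of the datum of the input is the
nonarchimedean part of the Literature-level `−|log(Θ)|`. [cite: DupuyHilado2025, §1 (1.1), Def. 3.6.3] -/
theorem negLogThetaDH_ofInput : (ofInput I).negLogThetaDH = I.negLogThetaNonarch := by
  rw [negLogThetaDH, ThetaVolumeInput.negLogThetaNonarch, PacketModel.lnνL]
  refine Finset.sum_congr rfl fun p hp => ?_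
  exact lnνLp_hullUTheta_ofInput I (I.prime_of_mem_supportPrimes hp)

/-! ## `−|log(q)|`: Thm. 3.10.1 at `P_q` -/

/-- At a prime `p`, `ln ν̄_{𝕃_p}(O_𝕃(−P_q)_p)` of the datum is the input's local `q`-summand.
[cite: DupuyHilado2025, Def. 3.6.3, §3.9] -/
theorem lnνLp_regionq_ofInput {p : ℕ} (hp : p.Prime) :
    (ofInput I).M.lnνLp I.lstar p ((ofInput I).M.region (ofInput I).tq) = I.negAbsLogQLoc p := by
  rw [I.negAbsLogQLoc_of_prime hp]
  exact ofIdelesM_lnνLp_region_tq I.X I.σ.localFieldFamily I.tΘ I.tΘ_ord I.tq I.tq_ord I.supportPrimes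
    (fun _ hp => I.prime_of_mem_supportPrimes hp) (fun _ hv => I.residueChar_mem_supportPrimes hv) hp

/-- `ln ν̄_𝕃(O_𝕃(−P_q))` of the datum is the sum of the input's local `q`-summands. [cite: DupuyHilado2025, Def. 3.6.3] -/
theorem lnνL_regionq_ofInput :
    (ofInput I).negAbsLogqDH = ∑ p ∈ I.supportPrimes, I.negAbsLogQLoc p := by
  rw [negAbsLogqDH, PacketModel.lnνL]
  refine Finset.sum_congr rfl fun p hp => ?_
  exact lnνLp_regionq_ofInput I (I.prime_of_mem_supportPrimes hp)

/-- **`ln ν̄_𝕃(O_𝕃(−P_q)) = −|log(q)|`** (Thm. 3.10.1 at `P_q`, now for the genuine model): Dupuy–Hilado's `q`-side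
number of the datum IS the Literature-level `negAbsLogQ I = −deĝ̲(P_q)`. [cite: DupuyHilado2025, Thm. 3.10.1] -/
theorem negAbsLogqDH_ofInput : (ofInput I).negAbsLogqDH = I.negAbsLogQ := by
  rw [negAbsLogqDH, lnνL_regionq]
  rfl

/-- Hence the Literature-level `−|log(q)| = −(1/2l)·log(q)` is the sum of its genuine local log-volumes.
[cite: DupuyHilado2025, Thm. 3.10.1] -/
theorem negAbsLogQ_eq_sum : I.negAbsLogQ = ∑ p ∈ I.supportPrimes, I.negAbsLogQLoc p := by
  rw [← negAbsLogqDH_ofInput, lnνL_regionq_ofInput]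

/-! ## (1.1), the estimate and the squeeze, transferred -/

/-- **Dupuy–Hilado's (1.1) for the datum of `I` ⟺ the Literature-level nonarchimedean form `Cor312NonarchOf I`**
(`−|log(q)| ≤ negLogThetaNonarch I`). HYPOTHESIS on both sides; nothing asserted. [claim: Mochizuki2012, status: disputed] -/
theorem cor312DH_ofInput_iff : (ofInput I).Cor312DH ↔ I.Cor312NonarchOf := by
  rw [Cor312DH, negLogThetaDH_ofInput]
  rfl

/-- **(1.1) ⟹ [IUTchIII] Cor. 3.12 for the input** (`Cor312Of I`, which carries the archimedean summand
`((l+5)/4)·log π > 0` of [IUTchIV] Step (vii) that Dupuy–Hilado's nonarchimedean `𝕃` omits — so (1.1) is the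
stronger form). [claim: Mochizuki2012, status: disputed] -/
theorem cor312Of_of_cor312DH (h : (ofInput I).Cor312DH) : I.Cor312Of :=
  I.cor312Of_of_cor312NonarchOf ((cor312DH_ofInput_iff I).mp h)

/-- **`EstimateDH δ` for the datum of `I` ⟺ `HullEstimateOf I δ`** (Thm. 3.10.1 at `P_Θ` turns
`ln ν̄_𝕃(O_𝕃(−P_Θ))` into `−deĝ̲_lgp(P_Θ)`). [cite: DupuyHilado2025, Thm. 3.10.1, §4.12] -/
theorem estimateDH_ofInput_iff (δ : ℝ) : (ofInput I).EstimateDH δ ↔ I.HullEstimateOf δ := by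
  rw [EstimateDH, negLogThetaDH_ofInput, lnνL_regionΘ]
  rfl

/-- **The free inequality for the genuine input, unconditionally**: `−deĝ̲_lgp(P_Θ) ≤ negLogThetaNonarch I`
(`O_𝕃(−P_Θ)` lies in the possible image of the identity indeterminacies, which lies in the hull; monotonicity —
with hull admissibility, Thm. 3.10.1 and (Ind1)/(Ind2)-invariance all theorems of Haar measure on the genuine
`⊗_{ℚ_p} K_{v̲_i}`). [cite: DupuyHilado2025, §4.10–4.12] -/
theorem free_inequality_input : -LgpDivisor.ndegLgp I.X.thetaPilot ≤ I.negLogThetaNonarch := by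
  rw [← negLogThetaDH_ofInput]
  exact (ofInput I).free_inequality

/-- Hence `HullEstimateOf I δ` forces `0 ≤ δ`. [cite: DupuyHilado2025, §4.12] -/
theorem hullEstimateOf_nonneg {δ : ℝ} (h : I.HullEstimateOf δ) : 0 ≤ δ := by
  have := free_inequality_input I
  unfold ThetaVolumeInput.HullEstimateOf at h
  linarith

/-- The squeeze for the genuine input at the DH level: (1.1) and the estimate give
`deĝ̲_lgp(P_Θ) − deĝ̲(P_q) ≤ δ` (c312-3's `gap_le_of_cor312DH_of_estimateDH`). [claim: Mochizuki2012, status: disputed] -/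
theorem gap_le_of_cor312DH_input {δ : ℝ} (h1 : (ofInput I).Cor312DH) (h2 : I.HullEstimateOf δ) :
    LgpDivisor.ndegLgp I.X.thetaPilot - FinDivisor.ndeg F₀ I.X.qPilot ≤ δ :=
  (ofInput I).gap_le_of_cor312DH_of_estimateDH h1 ((estimateDH_ofInput_iff I δ).mpr h2)

/-! ## Sharpness of the datum -/

/-- **The datum of an input is SHARP** at every prime: its (Ind3)-region is the bare region `O_𝕃(−P_Θ)` itself —
the `hsharp` hypothesis of c312-d1's per-summand Step (v) estimate, as a theorem for `ofInput`.
[cite: DupuyHilado2025, §4.10] -/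
theorem ofInput_sharp {p : ℕ} (hp : p.Prime) (j : ℕ) (e : Fin (j + 1) → placesOver F₀ p) :
    (ofInput I).ind3.bare3 p j e = (ofInput I).M.region (ofInput I).tΘ p j e :=
  ofIdelesM_bare3 I.X I.σ.localFieldFamily I.tΘ I.tΘ_ord I.tq I.tq_ord I.supportPrimes
    (fun _ hp => I.prime_of_mem_supportPrimes hp) (fun _ hv => I.residueChar_mem_supportPrimes hv) hp j e

/-- The sharpness in the `⊆` form used by `estimateDH_ofTensor_of_sharp`-type statements.
[cite: DupuyHilado2025, §4.10] -/
theorem ofInput_bare3_subset_region {p : ℕ} (hp : p.Prime) (j : ℕ) (e : Fin (j + 1) → placesOver F₀ p) :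
    (ofInput I).ind3.bare3 p j e ⊆ (ofInput I).M.region (ofInput I).tΘ p j e :=
  (ofInput_sharp I hp j e).le

/-! ## The computable half HOLDS for every genuine input (c312-d1's `estimateDH_ofIdelesM` through the bridge) -/

/-- **The explicit Step (v) discrepancy `δΣ(I)`** of abc-iut-c312-d1's `estimateDH_ofIdelesM` for the datum of the
input `I`: `Σ_{p ∈ T(I)} (1/ℓ⋇)·Σ_{j=1}^{ℓ⋇} Σ_{v⃗ ∈ V(F₀)_p^{j+1}} δ(p,j,v⃗)·Π_k Pr(v_k)` with
`δ(p,j,v⃗) = {θ(v_j) − min_a θ(v_a)} + {d_I + 1}·log p + Σ_{a : e_a > p−2} {3 + log e_a}`, `θ(v) = P_{Θ,j}(v)·ln|κ(v)|/n_v`,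
`d_I` the different sum and `e_a` the ramification indices of the GENUINE completions `K_{v̲_a}` ([IUTchIV] Thm. 1.10
Step (v) pp. 27–28, as assembled by c312-d1; copied verbatim with `𝔽 := I.σ.localFieldFamily`, `T := T(I)`).
[cite: Mochizuki2012, IUTchIV Thm. 1.10 Step (v) p. 27–28] -/
def explicitDelta : ℝ :=
  ∑ p ∈ I.supportPrimes, (1 / (I.X.lstar : ℝ)) * ∑ i : Fin I.X.lstar,
    ∑ e : Fin ((i : ℕ) + 1 + 1) → placesOver F₀ p,
      (fun (p j : ℕ) (e : Fin (j + 1) → placesOver F₀ p) =>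
          if h : p.Prime ∧ 0 < j ∧ j - 1 < I.X.lstar then
            haveI : Fact p.Prime := ⟨h.1⟩
            (I.X.thetaPilot ⟨j - 1, h.2.2⟩ (e (Fin.last j)).1 * logNorm F₀ (e (Fin.last j)).1
                / localDegree F₀ (e (Fin.last j)).1
              - Finset.univ.inf' ⟨0, Finset.mem_univ _⟩ (fun a =>
                  I.X.thetaPilot ⟨j - 1, h.2.2⟩ (e a).1 * logNorm F₀ (e a).1 / localDegree F₀ (e a).1))
            + (dSum p (fun a => (I.σ.localFieldFamily p h.1).k (e a)) + 1) * Real.log p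
            + ∑ a ∈ Finset.univ.filter (fun a => p - 2 < absRamificationIdx p ((I.σ.localFieldFamily p h.1).k (e a))),
                (3 + Real.log (absRamificationIdx p ((I.σ.localFieldFamily p h.1).k (e a))))
          else 0) p ((i : ℕ) + 1) e * ∏ k, weight F₀ (e k).1

/-- **THE COMPUTABLE HALF FOR EVERY GENUINE INPUT**: `negLogThetaNonarch I ≤ −deĝ̲_lgp(P_Θ) + δΣ(I)` — the
Literature-level `HullEstimateOf` with c312-d1's explicit constant, NOTHING assumed ([IUTchIV] Prop. 1.2 (ii) via
`prop12ii_holds`, the sharp (Ind3) reading via the minimal datum, hull admissibility / Thm. 3.10.1 / (Ind1)(Ind2)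
invariance all theorems of Haar measure on the genuine `⊗_{ℚ_p} K_{v̲_i}`). [cite: Mochizuki2012, IUTchIV Thm. 1.10 Steps (iv)–(viii) p. 26–30] -/
theorem hullEstimateOf_ofInput : I.HullEstimateOf (explicitDelta I) :=
  (estimateDH_ofInput_iff I _).mp
    (estimateDH_ofIdelesM I.X I.σ.localFieldFamily I.tΘ I.tΘ_ord I.tq I.tq_ord I.supportPrimes
      (fun _ hp => I.prime_of_mem_supportPrimes hp) (fun _ hv => I.residueChar_mem_supportPrimes hv))

/-- `0 ≤ δΣ(I)` (the free inequality). [cite: DupuyHilado2025, §4.12] -/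
theorem explicitDelta_nonneg : 0 ≤ explicitDelta I := hullEstimateOf_nonneg I (hullEstimateOf_ofInput I)

/-- **The squeeze for a genuine input, modulo (1.1) ONLY**: Dupuy–Hilado's (1.1) for the datum of `I` gives
`deĝ̲_lgp(P_Θ) − deĝ̲(P_q) ≤ δΣ(I)`; [IUTchIII]'s form `Cor312Of I` gives `… ≤ δΣ(I) + ((l+5)/4)·log π`.
HYPOTHESIS = Cor. 3.12 only. [claim: Mochizuki2012, status: disputed] -/
theorem gap_le_of_cor312Of (h : I.Cor312Of) :
    LgpDivisor.ndegLgp I.X.thetaPilot - FinDivisor.ndeg F₀ I.X.qPilot ≤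
      explicitDelta I + ThetaVolumeInput.archLogTheta I.l :=
  I.gap_le_of_cor312Of_of_hullEstimateOf h (hullEstimateOf_ofInput I)

end DHData

end Summit.ABC.IUTFork

end
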